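import Summits.BirchSwinnertonDyer.BirchSwinnertonDyer.Theorems.BiquadraticEisensteinDescentHeegnerTwistCouplingInSupplySymbolicMonskyEvenDesignDoor
import Summits.BirchSwinnertonDyer.BirchSwinnertonDyer.Theorems.BiquadraticEisensteinDescentHeegnerTwistCouplingInSupplySymbolicMonskyEvenDesignMuOne
import HarnessLib

set_option linter.dupNamespace false -- `Summit.BirchSwinnertonDyer.BirchSwinnertonDyer.Theorems.…` (summit = sub)
set_option autoImplicit false

/-!
# Crux `HeegnerTwistCouplingInSupply` (stmt-BirchSwinnertonDyer-21381) — the μ = 1 EVEN design at `δ = 1` THROUGH THE REALISATION DOOR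

Route `BiquadraticEisensteinDescent` (cell `pub/bsd-wall`, width seat `bsd-wall-cm-bed-w3` g24; `--supports` 21381, helper). Combines the
two-condition μ = 1 even design theorem `exists_patternFree_even_design_one_of_muOne` (`…SymbolicMonskyEvenDesignMuOne`: for an even base with
exactly one prime `≡ 3 (mod 4)` the `0 × V` condition of EVEN THEOREM A holds automatically at `δ = 1`) with the realisation door
`RealisesK.cruxOn_even_of_BT_of_forall` (w3 g21), exactly as `exists_recipe_cruxOn_even_pencil` (p748270) does for EVEN THEOREM A:
* ★★★ `exists_recipe_cruxOn_even_one_of_muOne` — for every even base `2·P₀⋯P_k` with exactly one `P_b ≡ 3 (mod 4)` whose even pencil at `δ = 1`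
  meets `V × 0` and the diagonal in dimension `≤ τ₀^{ev}`, there is ONE list `aux` of `τ₀^{ev} + 1` auxiliary cells with `heegnerK` such that ANY
  realising primes `P`, `q` in the size window `√(∏q)·log(∏q) < π·P₀` give an imaginary quadratic `K`, `|d_K| > 4`, Heegner for `N(E_{2n})`,
  `L(E_{2n}^{(d_K)}, 1) ≠ 0` and `P₀ ∤ h(K)` — the CONCLUSION of `HeegnerTwistCouplingInSupply` at `(E_{2n}, P₀)`, modulo the named print fact
  Burungale–Tian only.

HONEST FRAMING: RUNG-LEVEL corner layer (even congruent `j = 1728` families `E_{2n₀}`); instances still need located primes in the window (Linnik /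
Chebotarev supply, the w4 layer) and the print input (Burungale–Tian); the crux as stated (C⁺), its registered stubs and BSD are NOT touched; nothing
is closed. THEOREMS ONLY.
References: [HeathBrown1994] appendix (Monsky), typescript p. 41 L20–L36; [BurungaleTian2026, Thm. 1.1]; [Oesterle1988Gauss, II §3 p. 57 (27)].
-/

namespace Summit.BirchSwinnertonDyer.BirchSwinnertonDyer.Theorems.SymbolicMonsky

section MuOneEvenDoor

open Matrix Module Literature.NumberTheory.EllipticCurves Literature.NumberTheory.EllipticCurves.HeathBrown1994
  Literature.NumberTheory.EllipticCurves.HeathBrown1994.Families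
open Literature.NumberTheory.EllipticCurves.Rank1Residual

variable {k : ℕ} (base : SymbData (k + 1))

/-- ★★★ **μ = 1 even bases through the door (two conditions at `δ = 1`)**: for every even base `2·P₀⋯P_k` with exactly one prime `≡ 3 (mod 4)`
(index `b₀`) whose even pencil `W_ev(1)` meets `V × 0` and the diagonal in dimension `≤ τ₀^{ev} = (dim 𝒦_ev + 1)/2`, one cell list `aux`
(`τ₀^{ev} + 1` cells, `heegnerK`) such that any realising primes in the size window give the conclusion of `HeegnerTwistCouplingInSupply` at
`(E_{2n}, P₀)`, modulo Burungale–Tian. [cite: HeathBrown1994SelmerCongruentII, Appendix (Monsky), typescript p. 41 L20–L36]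
[cite: BurungaleTian2026, Thm. 1.1] [cite: Oesterle1988Gauss, II §3 Proposition p. 57 (27)] -/
theorem exists_recipe_cruxOn_even_one_of_muOne (hBT : burungaleTian_analyticRank_eq_zero_of_selmerCorank_eq_zero_of_hasCM)
    (b₀ : Fin (k + 1)) (hμ : ∀ b, negNegOne (base.cls b) = true ↔ b = b₀)
    (h1 : finrank (ZMod 2) ↥(base.evenPencil (fun _ => 1) ⊓
      LinearMap.ker (LinearMap.snd (ZMod 2) (Fin (k + 1) → ZMod 2) (Fin (k + 1) → ZMod 2))) ≤
        (finrank (ZMod 2) ↥base.evenVirtualKernel + 1) / 2)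
    (h3 : finrank (ZMod 2) ↥(base.evenPencil (fun _ => 1) ⊓
      LinearMap.ker (LinearMap.fst (ZMod 2) (Fin (k + 1) → ZMod 2) (Fin (k + 1) → ZMod 2) +
        LinearMap.snd (ZMod 2) (Fin (k + 1) → ZMod 2) (Fin (k + 1) → ZMod 2))) ≤
        (finrank (ZMod 2) ↥base.evenVirtualKernel + 1) / 2) :
    ∃ aux : List AuxCell, aux.length = (finrank (ZMod 2) ↥base.evenVirtualKernel + 1) / 2 + 1 ∧ heegnerK base aux = true ∧
      ∀ (P : Fin (k + 1) → ℕ) (q : Fin aux.length → ℕ), RealisesK base aux P q →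
        ∀ (n : ℕ) [(congruentNumberCurve (2 * n)).IsElliptic], (∏ b, P b) = n →
          Real.sqrt ((∏ j, q j : ℕ) : ℝ) * Real.log ((∏ j, q j : ℕ) : ℝ) < Real.pi * P 0 →
          ∃ (K : Type) (_ : Field K) (_ : NumberField K),
            IsImaginaryQuadratic K ∧ 4 < (NumberField.discr K).natAbs ∧
            SatisfiesHeegnerHypothesis ((congruentNumberCurve (2 * n)).conductorNorm ℤ) K ∧
            ((congruentNumberCurve (2 * n)).quadraticTwist (NumberField.discr K : ℚ)).entireLFunction 1 ≠ 0 ∧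
            ¬ P 0 ∣ NumberField.classNumber K := by
  obtain ⟨c₁, rest, hlen, hH, hdet⟩ := exists_patternFree_even_design_one_of_muOne base b₀ hμ h1 h3
  refine ⟨c₁ :: rest, by simp [hlen], hH, ?_⟩
  intro P q hR n _ hn hsize
  exact hR.cruxOn_even_of_BT_of_forall hBT hH hdet hn hsize

end MuOneEvenDoor

end Summit.BirchSwinnertonDyer.BirchSwinnertonDyer.Theorems.SymbolicMonsky
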